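import Summits.BirchSwinnertonDyer.BirchSwinnertonDyer.Theorems.QuadraticBranchSignedControlPlusEtaNonsurjOfUpperOfLowerBSD
import Literature.NumberTheory.EllipticCurves.ComplexMultiplication
import Literature.NumberTheory.EllipticCurves.ComplexMultiplicationHasCMProofs
import Literature.NumberTheory.EllipticCurves.BSDRootNumberSmallConductorAssemblyProofs
import HarnessLib

/-!
# Route `QuadraticBranchSignedControl` (rung K8, cell `bsd-potss`), residual crux
# `PlusEtaMainConjectureNonsurj` (stmt-BirchSwinnertonDyer-19606), stub `stub_etaMC_cm`: on the CM rows
# of analytic rank `0` the lower half of `BSD_p` is IN PRINT (Burungale–Flach 2024, bsd.S28), so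
# Kobayashi's even main conjecture at `η` there is EXACTLY its Kato-side half (seat `bsd-potss-ctrl` g4)

WHAT. For a CM curve `V/ℚ`, good at `p ≥ 5` with `a_p(V) = 0` (`p` inert in the CM field; the
`p`-adic tower is then never onto — Zywina), its additive partner `W` (`C • W^{(p*)} = V`) is CM too
(`HasCM` is a `j`-invariant property, `hasCM_iff_of_j_eq`), and if `L(W,1) ≠ 0` the FULL
Birch–Swinnerton-Dyer formula for `W` is the named fact bsd.S28
`bsdTriple_of_hasCM_of_L_one_ne_zero` (Burungale–Flach 2024 Thm. 1.1 + Cor. 2, with Cassels'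
isogeny invariance); hence `BSDp W p` (`forall_bsdp_of_bsdTriple'`), hence
`Typed.MissingLowerBoundAt W p`. Feeding this into the converse road of seat ctrl g4
(`ConverseControl.quadraticBranchPlusEtaMainConjectureAt_of_etaUpperIntegral_of_missingLowerBoundAt`,
p464359) gives:

  on the CM rank-`0` rows, (C1⁺_η)(V) — the conclusion of `stub_etaMC_cm` — ⟸ the INTEGRAL upper
  inclusion `(L_p⁺(V,η,X)) ⊆ Char(X⁺(V/K_∞)^η)` at `(V,p)` (displayed, verbatim `EtaUpperIntegralAt`)
  + Poitou–Tate + modularity + GZK + Kobayashi 2.2 at `η` + Kitajima–Otsuki 1.3 at `η` + bsd.S28,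

with NO per-row input at all: the Eisenstein half of Kobayashi's even main conjecture at `η` is FREE on
these rows, granted its Kato-side half. (The CM stub's own road — Rubin's two-variable main conjecture
+ the `η`-isotypic descent of Pollack–Rubin 2004 p. 448 — would give both halves at once; this file
does not touch it.)

* `ConverseControl.quadraticBranchPlusEtaMainConjectureAt_of_etaUpperIntegral_of_hasCM_rankZero` —
  pair form (`V` CM, partner `W` with `L(W,1) ≠ 0`).
* `etaMC_cm_rankZeroRows_of_upper` — the ∀-form on the binders of `stub_etaMC_cm` (`¬ onto` displayed
  and idle), with the partner `W`, `C • W^{(p*)} = V`, `L(W,1) ≠ 0` as the row's rank-`0` condition.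

HONEST FRAMING (cell `bsd-potss`, run/shared/lean/pub/bsd-potss/; FULL-BSD rank ≤ 1 programme,
tranche 1b, HUMAN RULING D-0036/D-0074): BOOKKEEPING THEOREMS ONLY — no definition, no named Literature
fact minted, no Summits-side `def … : Prop`, no `sorry`, axioms standard. CONDITIONAL on: the integral
upper inclusion at `η` for CM `V` (hypothesis position; Kato's Thm. 12.5 (4) does not supply it — the
image is the normaliser of a Cartan), Poitou–Tate duality, modularity, GZK, Kobayashi 2003 Thm. 2.2 at
`η`, Kitajima–Otsuki 2018 Main Thm. 1.3 at `η`, Burungale–Flach 2024 (bsd.S28) — named facts, not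
proved in the tree. `stub_etaMC_cm` is NOT proved by name; the crux 19606 stays OPEN; rank-`1` CM
rows are not touched; nothing is booked; no label / mark / count moves; `BSD(W,p)` is USED (as the
printed theorem bsd.S28 in hypothesis position), claimed for no new pair.
`--supports stmt-BirchSwinnertonDyer-19606`.

References: [Kobayashi2003] Thm. 2.2 (p. 5), §4 Even main conjecture + Thm. 4.1 (p. 8);
[PollackRubin2004] Theorem and remark p. 448; [BurungaleFlach2024] Thm. 1.1 and Cor. 2;
[KitajimaOtsuki2018] Main Thm. 1.3; [MilneADT2006] I Thm. 4.10, I.7.3; [Miller2011LMS] Def. 1.1;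
[Zywina2015] (CM images; shape only); [SilvermanAEC2009] III.1.4(b).
-/

set_option autoImplicit false
set_option linter.dupNamespace false

noncomputable section

open scoped Classical

open CongruenceSubgroup Field Function NumberField IsDedekindDomain WeierstrassCurve
open Literature.NumberTheory.EllipticCurves
open Literature.NumberTheory.EllipticCurves.ModularForms
open Literature.NumberTheory.EllipticCurves.Rank1Residual
open Literature.NumberTheory.EllipticCurves.Rank1Residual.Typed
open Literature.NumberTheory.GaloisRepresentations
open Literature.NumberTheory.GaloisCohomology
open Literature.NumberTheory.EllipticCurves.IwasawaAlgebra
open Literature.NumberTheory.EllipticCurves.IwasawaDual ZpExtension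
open Summit.BirchSwinnertonDyer.Rank1Residual.X11b.Levels
open Summit.BirchSwinnertonDyer.Rank1Residual.X11b
open Summit.BirchSwinnertonDyer.Rank1Residual.Additive
open Summit.BirchSwinnertonDyer.Rank1Residual.Additive.SignedTwist
open scoped ContRepresentation
open Summit.BirchSwinnertonDyer.Rank1Residual.AdditivePotMult

namespace Summit.BirchSwinnertonDyer.BirchSwinnertonDyer.Theorems

namespace ConverseControl

variable (W : WeierstrassCurve ℚ) [W.IsElliptic] [W.IsGloballyMinimal] (p : ℕ) [hp : Fact p.Prime]

/-- **(C1⁺_η)(V) on a CM pair of analytic rank `0` from the integral upper inclusion at `η` ALONE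
(all else in print).** `V` CM, good at `p ≥ 5` with `a_p(V) = 0`, `C • W^{(p*)} = V` with `W`
globally minimal and `L(W,1) ≠ 0`: then `W` is CM (`hasCM_iff_of_j_eq`, `j(V) = j(W)`), so bsd.S28
(`bsdTriple_of_hasCM_of_L_one_ne_zero`, Burungale–Flach 2024) gives `W.BSDTriple`, hence `BSDp W p`
(`forall_bsdp_of_bsdTriple'`), hence `Typed.MissingLowerBoundAt W p` (`missingPPartAt_of_bsdp`,
`lower_and_upper_of_missingPPartAt`; `Ш(W)` finite is the `ShaFinite` conjunct), and the converse road
`quadraticBranchPlusEtaMainConjectureAt_of_etaUpperIntegral_of_missingLowerBoundAt` concludes.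
CONDITIONAL on the displayed named facts and on the integral upper inclusion `hup`; nothing booked.
[cite: BurungaleFlach2024, Thm 1.1 and Cor. 2] [cite: Kobayashi2003, §4 Even main conjecture (p. 8), Thm. 2.2 (p. 5)]
[cite: SilvermanAEC2009, III.1.4(b)] [cite: Miller2011LMS, Def. 1.1] -/
theorem quadraticBranchPlusEtaMainConjectureAt_of_etaUpperIntegral_of_hasCM_rankZero
    (hPT : poitouTate_selmerStructure_duality_real ℚ) (hmod : hasEntireLFunction_rat)
    (hGZK : rank_eq_analyticRank_of_analyticRank_le_one)
    (h22 : Kobayashi2003.thm22_etaSignedSelmerDual_finite_torsion)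
    (hKO : KitajimaOtsuki2018.mainThm13_etaSignedSelmerDual_noFiniteSubmodule)
    (hS28 : bsdTriple_of_hasCM_of_L_one_ne_zero)
    (V : WeierstrassCurve ℚ) [V.IsElliptic] [V.IsGloballyMinimal] (C : VariableChange ℚ)
    (hp5 : 5 ≤ p) (hCV : C • W.quadraticTwist ((-1) ^ (p / 2) * p) = V)
    (hgood : V.HasGoodReductionAtPrime p) (hap : V.frobeniusTrace p = 0) (hCM : V.HasCM)
    (hup : ∀ (K₀ : Type) [Field K₀] [NumberField K₀] [IsCyclotomicExtension {p} ℚ K₀]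
        [(galRange (K := ℚ) K₀).Normal] (ηq : absoluteGaloisGroup ℚ →* ℤˣ),
        (∀ σ ∈ galRange (K := ℚ) K₀, ηq σ = 1) → ηq ≠ 1 →
      ∀ {N : ℕ} [NeZero N] {f : CuspForm (Gamma0 N) 2},
        p ≠ 2 → V.HasGoodReductionAtPrime p → V.frobeniusTrace p = 0 → IsNewformOf V f →
      ∀ (ϖ : ℚ), (if Even (p / 2) then (ϖ : ℝ) * V.realPeriodRat = plusPeriod f
          else (ϖ : ℝ) * V.imaginaryPeriodRat = minusPeriod f) →
      ∀ (Lη : IwasawaAlgebra p), IsQuadraticBranchPlusLFunction f p ϖ Lη →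
      ∀ (κ : ZpExtension ℚ p) (γ : absoluteGaloisGroup ℚ),
        κ.IsCyclotomic → κ.IsTopGenerator γ → γ ∈ galRange (K := ℚ) K₀ → IsCyclotomicVariable p γ →
      ∀ (D : EtaSignedSelmerDualData V κ K₀ ℚ_[p] ηq γ 1), Ideal.span {Lη} ≤ D.charIdeal)
    (hLW : W.entireLFunction 1 ≠ 0) :
    QuadraticBranchPlusEtaMainConjectureAt V p := by
  have hd : ((-1 : ℚ) ^ (p / 2) * p) ≠ 0 :=
    mul_ne_zero (pow_ne_zero _ (neg_ne_zero.mpr one_ne_zero)) (Nat.cast_ne_zero.mpr hp.out.ne_zero)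
  haveI := W.isElliptic_quadraticTwist hd
  -- `W` is CM: `j(V) = j(W^{(p*)}) = j(W)`
  have hj : V.j = W.j := by subst hCV; rw [variableChange_j, j_quadraticTwist W hd]
  have hCMW : W.HasCM := (hasCM_iff_of_j_eq hj).mp hCM
  -- bsd.S28: the full BSD formula for the CM curve `W` of analytic rank `0`
  have hT : W.BSDTriple := hS28 W hCMW hLW
  haveI : Finite W.sha := hT.2.1
  have hbsd : BSDp W p := forall_bsdp_of_bsdTriple' W hT p hp.out
  have hlow : MissingLowerBoundAt W p :=
    (lower_and_upper_of_missingPPartAt W p (missingPPartAt_of_bsdp W p hbsd)).1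
  exact quadraticBranchPlusEtaMainConjectureAt_of_etaUpperIntegral_of_missingLowerBoundAt W p hPT hmod
    hGZK h22 hKO V C hp5 hCV hgood hap hup hLW hlow

end ConverseControl

/-- **19606's CM stub on its analytic-rank-`0` rows = the integral upper inclusion at `η` alone.** On
the binders of `stub_etaMC_cm` (`p ≥ 5`, `V` good with `a_p = 0`, tower NOT onto — displayed, idle —
`V` CM), together with the row's rank-`0` condition spelled on the additive partner (`W` globally
minimal, `C • W^{(p*)} = V`, `L(W,1) ≠ 0`): the conclusion of `stub_etaMC_nonCM_upper`'s shape at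
`(V,p)` (`EtaUpperIntegralAt V p`, verbatim) gives the crux's conclusion
`QuadraticBranchPlusEtaMainConjectureAt V p`, granted Poitou–Tate, modularity, GZK, Kobayashi 2.2 at
`η`, Kitajima–Otsuki 1.3 at `η` and Burungale–Flach's bsd.S28 (named facts — no per-row input).
CONDITIONAL; `stub_etaMC_cm` is not proved by name; rank-`1` CM rows untouched.
[cite: BurungaleFlach2024, Thm 1.1 and Cor. 2] [cite: PollackRubin2004, Theorem and remark p. 448]
[cite: Kobayashi2003, §4 (p. 8)] -/
theorem etaMC_cm_rankZeroRows_of_upper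
    (hPT : poitouTate_selmerStructure_duality_real ℚ) (hmod : hasEntireLFunction_rat)
    (hGZK : rank_eq_analyticRank_of_analyticRank_le_one)
    (h22 : Kobayashi2003.thm22_etaSignedSelmerDual_finite_torsion)
    (hKO : KitajimaOtsuki2018.mainThm13_etaSignedSelmerDual_noFiniteSubmodule)
    (hS28 : bsdTriple_of_hasCM_of_L_one_ne_zero) :
    ∀ (V : WeierstrassCurve ℚ) [V.IsElliptic] [V.IsGloballyMinimal] (p : ℕ) [Fact p.Prime],
      5 ≤ p → V.HasGoodReductionAtPrime p → V.frobeniusTrace p = 0 →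
      ¬ (∀ m : ℕ, V.HasSurjectiveModNGaloisRep (p ^ m : ℕ)) → V.HasCM →
      (∀ (K₀ : Type) [Field K₀] [NumberField K₀] [IsCyclotomicExtension {p} ℚ K₀]
          [(galRange (K := ℚ) K₀).Normal] (ηq : absoluteGaloisGroup ℚ →* ℤˣ),
          (∀ σ ∈ galRange (K := ℚ) K₀, ηq σ = 1) → ηq ≠ 1 →
        ∀ {N : ℕ} [NeZero N] {f : CuspForm (Gamma0 N) 2},
          p ≠ 2 → V.HasGoodReductionAtPrime p → V.frobeniusTrace p = 0 → IsNewformOf V f →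
        ∀ (ϖ : ℚ), (if Even (p / 2) then (ϖ : ℝ) * V.realPeriodRat = plusPeriod f
            else (ϖ : ℝ) * V.imaginaryPeriodRat = minusPeriod f) →
        ∀ (Lη : IwasawaAlgebra p), IsQuadraticBranchPlusLFunction f p ϖ Lη →
        ∀ (κ : ZpExtension ℚ p) (γ : absoluteGaloisGroup ℚ),
          κ.IsCyclotomic → κ.IsTopGenerator γ → γ ∈ galRange (K := ℚ) K₀ → IsCyclotomicVariable p γ →
        ∀ (D : EtaSignedSelmerDualData V κ K₀ ℚ_[p] ηq γ 1), Ideal.span {Lη} ≤ D.charIdeal) →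
      ∀ (W : WeierstrassCurve ℚ) [W.IsElliptic] [W.IsGloballyMinimal] (C : VariableChange ℚ),
        C • W.quadraticTwist ((-1) ^ (p / 2) * p) = V → W.entireLFunction 1 ≠ 0 →
        QuadraticBranchPlusEtaMainConjectureAt V p := by
  intro V _ _ p _ hp5 hgood hap _ hCM hup W _ _ C hCV hLW
  exact ConverseControl.quadraticBranchPlusEtaMainConjectureAt_of_etaUpperIntegral_of_hasCM_rankZero W p
    hPT hmod hGZK h22 hKO hS28 V C hp5 hCV hgood hap hCM hup hLW

end Summit.BirchSwinnertonDyer.BirchSwinnertonDyer.Theorems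

end
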